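import Literature.NumberTheory.PAdicHodge.RecognitionFromTeichLog
import HarnessLib

/-!
# `⟨[η], P⟩ = −Tr_{F/ℚ_p}(c_P · b)` at a completion from the `X₂`-membership of the Legendre resolution

Topic `Literature/NumberTheory/PAdicHodge`; THEOREMS ONLY (no definition, no named fact, no instance, no `sorry`). The assembly socket
`ReciprocityCalibrationSocket.tatePairingPoint_eq_neg_trace_of_recognition` (edix-p4 g20) fed with the recognition data of
`RecognitionFromTeichLog.exists_recognition_of_isTeichLog` and the Legendre presentation `TatePairingCochainLegendre.isCoboundaryLift_legendreCochain`:

★★ `tatePairingPoint_eq_neg_trace_of_isTeichLog` — at a completion `F = K_v`, `v ∣ p`: for Legendre period data `Pω ⊆ Fil¹`, `Pη`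
(`Pω(S)Pη(T) − Pη(S)Pω(T) = ι(e_∞(S,T))`), a Kummer cocycle `κ` of the point `P` integrated by `(b_ω, b_η)` with `θ(b_ω) = ι_F(c_P)`, a
`ℤ_p`-lift `ψ` of `log χ_cyclo`, and under the two hypotheses
(HT) `θ(Pη(η σ)) = θ(ψ σ) · ι_F(b) + (σ m − m)` (the Hodge–Tate reading of `exp*(η)`),
(K₂) `p^N · x̃(η σ) ∈ X⁰₂` for all `σ`, `p`-adically small near `1` (the `X₂`-membership of the resolution — Kato's `x ∈ X ⊗ V`),
one has **`⟨[η], P⟩ = −Tr_{F/ℚ_p}(c_P · b)`** in `ℚ_p`. With Fontaine's integrating element (`c_P = log_ω P`) and the dual exponential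
(`b = −c₀ · exp*_d(η)`) this IS the displayed formula of `EllipticCurves.tatePairingPoint_eq_trace_expStar_log` at `(η, P)`:
Kato's explicit reciprocity law [REC] at a completion, reduced — without `B_crys` or `φ` — to (HT) and (K₂).

Line `kato_lever` of crux K★ `stmt-BirchSwinnertonDyer-22226`; BSD / K★ / [REC] are NOT proved by any of this ((HT), (K₂) are hypotheses).

## References
* K. Kato, LNM 1553 (1993), Ch. II Thm. 1.4.1 (3)–(4), Lemma 1.4.3–1.4.5, §1.4.4. [Kato1993LNM1553]
* S. Bloch, K. Kato (1990), Ex. 3.10.1, Example 3.11 (3.11.1). [BlochKato1990]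
* J.-M. Fontaine, Y. Ouyang, *Theory of p-adic Galois representations*, §6.1. [FontaineOuyang2022]
-/

noncomputable section

open Field Function ValuativeRel WittVector NumberField IsDedekindDomain
open scoped NumberField Topology

namespace Literature.NumberTheory.PAdicHodge

open Literature.NumberTheory.GaloisRepresentations
open Literature.NumberTheory.GaloisRepresentations.IsNonarchimedeanLocalField
open Literature.NumberTheory.GaloisCohomology
open Literature.NumberTheory.EllipticCurves
open Literature.NumberTheory.PAdicHodge.GaloisContinuity
open Literature.IUT.LogVolume
open _root_.WeierstrassCurve

section Completion

variable {K : Type} [Field K] [NumberField K] {p : ℕ} [hprime : Fact p.Prime] (v : HeightOneSpectrum (𝓞 K))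
  [CharZero (v.adicCompletion K)] [LocallyCompactSpace (absoluteGaloisGroup (v.adicCompletion K))]
  [Fact (¬ IsUnit (p : integerC (v.adicCompletion K)))]
  [IsAdicComplete (Ideal.span {(p : integerC (v.adicCompletion K))}) (integerC (v.adicCompletion K))]
  {K₀ : Type} [Field K₀] [CharZero K₀] (W : WeierstrassCurve K₀) [W.IsElliptic] [Algebra K₀ (v.adicCompletion K)]
  (e : (k : ℕ) → geomTorsion W ((p ^ k : ℕ) : ℤ) → geomTorsion W ((p ^ k : ℕ) : ℤ) → AlgebraicClosure K₀)
  (hμ : ∀ k S T, e k S T ^ (p ^ k) = 1) (hadd₁ : ∀ k S₁ S₂ T, e k (S₁ + S₂) T = e k S₁ T * e k S₂ T)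
  (hadd₂ : ∀ k S T₁ T₂, e k S (T₁ + T₂) = e k S T₁ * e k S T₂)
  (hgal : ∀ k (σ : absoluteGaloisGroup K₀) (S T : geomTorsion W ((p ^ k : ℕ) : ℤ)), σ • e k S T = e k (σ • S) (σ • T))
  (hcompat : ∀ k (S T : geomTorsion W ((p ^ (k + 1) : ℕ) : ℤ)),
    e k (torsionMulHom W (p ^ (k + 1)) (p ^ k) p (pow_succ p k).symm S)
      (torsionMulHom W (p ^ (k + 1)) (p ^ k) p (pow_succ p k).symm T) = e (k + 1) S T ^ p)
  {Pω Pη : W.tateModule p →+ BdRPlusTop (v.adicCompletion K) p}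
  (hPω : ∀ (σ : absoluteGaloisGroup (v.adicCompletion K)) (a : W.tateModule p),
    BdRPlusTop.gal (v.adicCompletion K) p σ (Pω a) = Pω (restrictedTateRep W (v.adicCompletion K) p σ a))
  (hPη : ∀ (σ : absoluteGaloisGroup (v.adicCompletion K)) (a : W.tateModule p),
    BdRPlusTop.gal (v.adicCompletion K) p σ (Pη a) = Pη (restrictedTateRep W (v.adicCompletion K) p σ a))
  (hLeg : ∀ S T : W.tateModule p, Pω S * Pη T - Pη S * Pω T =
    BdRPlusTop.periodLine (v.adicCompletion K) p ((weilContPairingPadic W (v.adicCompletion K) p e hμ hadd₁ hadd₂ hgal hcompat).toLin S T))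

include hPω hPη hLeg in
/-- ★★ **`⟨[η], P⟩ = −Tr_{F/ℚ_p}(c_P · b)` from (HT) and (K₂)** — Kato's explicit reciprocity law at a completion `F = K_v`, reduced
without `B_crys` to the Hodge–Tate reading (HT) of `exp*(η)` and the `X₂`-membership (K₂) of the Legendre resolution of the Kummer
cocycle of `P` (`RecognitionFromTeichLog.exists_recognition_of_isTeichLog` + `TatePairingCochainLegendre.isCoboundaryLift_legendreCochain` +
the socket `tatePairingPoint_eq_neg_trace_of_recognition`). [cite: Kato1993LNM1553, Ch. II Thm. 1.4.1 (3)–(4) and Lemma 1.4.3–1.4.5]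
[cite: BlochKato1990, Ex. 3.10.1 and Example 3.11] [cite: FontaineOuyang2022, §6.1] -/
theorem tatePairingPoint_eq_neg_trace_of_isTeichLog
    (hpv : valuation (v.adicCompletion K) (p : v.adicCompletion K) < 1)
    (hF : Function.Surjective (fontaineTheta (integerC (v.adicCompletion K)) p))
    (ψ : C(absoluteGaloisGroup (v.adicCompletion K), ℤ_[p])) (hψ : ∀ σ τ, ψ (σ * τ) = ψ σ + ψ τ)
    (hψlog : ∀ τ, (ψ τ : ℚ_[p]) = logCyclotomic (F := v.adicCompletion K) p τ)
    (hfil : ∀ a, Pω a ∈ (BdRPlusTop.filOne (v.adicCompletion K) p).toIdeal)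
    (η κ : contOneCocycles (restrictedTateRep W (v.adicCompletion K) p).toTopRep)
    (P : (W.baseChange (v.adicCompletion K)).toAffine.Point)
    (hκ : ∀ j, (cohomologyMap (tateProjMor W (v.adicCompletion K) p j) 1).hom (oneCocycleClass _ κ) =
      kummerLevelClass W (v.adicCompletion K) p j P)
    {bω bη : BdRPlusTop (v.adicCompletion K) p}
    (hbω : ∀ τ, Pω (κ.1 τ) = BdRPlusTop.gal (v.adicCompletion K) p τ bω - bω)
    (hbη : ∀ τ, Pη (κ.1 τ) = BdRPlusTop.gal (v.adicCompletion K) p τ bη - bη)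
    {cP : v.adicCompletion K}
    (hθb : thetaBdR ((BdRPlusTop.of (v.adicCompletion K) p).symm bω) = algebraMap (v.adicCompletion K) (CompletedAlgClosure (v.adicCompletion K)) cP)
    {b : v.adicCompletion K} {m : CompletedAlgClosure (v.adicCompletion K)}
    (hβ : ∀ σ, thetaBdR ((BdRPlusTop.of (v.adicCompletion K) p).symm (Pη (η.1 σ))) =
      thetaBdR (qpToBdR (ψ σ : ℚ_[p]) : BDeRhamPlus (integerC (v.adicCompletion K)) p) *
        algebraMap (v.adicCompletion K) (CompletedAlgClosure (v.adicCompletion K)) b + (σ • m - m))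
    {N : ℕ} (hX : ∀ σ, IsTeichLog 2 ((BdRPlusTop.of (v.adicCompletion K) p).symm
      ((p : BdRPlusTop (v.adicCompletion K) p) ^ N * (Pη (η.1 σ) * bω - Pω (η.1 σ) * bη))))
    (hXsmall : ∀ M' : ℕ, ∀ᶠ σ in 𝓝 (1 : absoluteGaloisGroup (v.adicCompletion K)),
      ∃ L' : BDeRhamPlus (integerC (v.adicCompletion K)) p, IsTeichLog 2 L' ∧
        (BdRPlusTop.of (v.adicCompletion K) p).symm ((p : BdRPlusTop (v.adicCompletion K) p) ^ N * (Pη (η.1 σ) * bω - Pω (η.1 σ) * bη)) -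
          (p : BDeRhamPlus (integerC (v.adicCompletion K)) p) ^ M' * L' ∈
            Ideal.span {(xiBdR : BDeRhamPlus (integerC (v.adicCompletion K)) p) ^ 2}) :
    letI := LocalField.padicAlgebra (v.adicCompletion K) p hpv
    ((tatePairingPoint W (v.adicCompletion K) p e hμ hadd₁ hadd₂ hgal hcompat (oneCocycleClass _ η) P : ℤ_[p]) : ℚ_[p]) =
      -Algebra.trace ℚ_[p] (v.adicCompletion K) (cP * b) := by
  obtain ⟨k, u, hu, hu1, h, z, hlog, hz, e_rec⟩ := BdRPlusTop.exists_recognition_of_isTeichLog hpv hF W e hμ hadd₁ hadd₂ hgal hcompat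
    hPω hPη hLeg hfil η κ hbω hbη hθb ψ hψ hβ hX hXsmall
  exact tatePairingPoint_eq_neg_trace_of_recognition v W e hμ hadd₁ hadd₂ hgal hcompat hpv hF ψ hψ hψlog hu hu1 (cP * b) k hlog η κ P
    hκ (BdRPlusTop.isCoboundaryLift_legendreCochain W e hμ hadd₁ hadd₂ hgal hcompat hPω hPη hLeg η κ hbω hbη) h z hz e_rec

end Completion

end Literature.NumberTheory.PAdicHodge

end
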